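import Literature.MathematicalPhysics.QuantumFieldTheory.Balaban1983to89.T4LimitLaw
import Literature.MathematicalPhysics.QuantumFieldTheory.Balaban1983to89.T4LimitDensityT4

/-!
# `Balaban1983to89.T4LimitLawField` — the dictionary between the FIELD-LEVEL laws of the averaged fields
# (`T4LimitDensityT4.unitLaw`, on `X = G^{unit bonds}`) and the OBSERVABLE laws (`T4LimitLaw.apexLaw`, on the cube
# `[-1,1]^{ULoop F}`): the latter are the push-forwards of the former under the LOOP VECTOR, and weak convergence passes
# down (cell `pub-balaban`, road item (2) "T⁴ continuum", `t4/T4-DAG.md` nodes E1 / U0 / E4; journal row T4-U0.M*-F)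

CITATION HEADER (lean-in-tree rule 2026-08-18).  This module asserts NO statement of Bałaban's series and contains NO
quotation: every declaration is `[folklore]` bookkeeping over the tree's definitions (`T4LimitLaw.apexLaw/law/obsVec`,
`T4LimitDensityT4.unitLaw/unitLawP/topLaw/cfgEquiv/unitObs`, `T4Continuum.FiniteEpsData.scheme/avgObs`,
Mathlib `Measure.map`, `ProbabilityMeasure.map`, `ProbabilityMeasure.tendsto_map_of_tendsto_of_continuous`).  The two
imported modules are untouched; their certified headers carry the (context-only) quotations of the programme.

WHAT IS PROVED HERE (kernel, sorry-free).  For Bałaban-type finite-ε data `D : T4Continuum.FiniteEpsData F G` and bare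
couplings `g₀`:
* `loopVec F G : X → [-1,1]^{ULoop F}`, `W ↦ (C ↦ Re tr 𝒲_C(W)/N)` — the vector of ALL unit-scale loop variables as ONE
  fixed map on the unit-lattice configuration space `X = T4LimitDensityT4.UCfg F G` (product-measurable,
  `measurable_loopVec`; continuous when `Re tr` and the group operations are, `continuous_loopVec`); the scheme's
  observable vector factors through it: `obsVec (D.scheme g₀) K = loopVec ∘ cfgEquiv K ∘ avg^K` (`obsVec_scheme_eq`).
* **THE OBSERVABLE LAW IS THE PUSH-FORWARD OF THE FIELD-LEVEL LAW**: `(apexLaw D hM g₀ K : Measure _) =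
  (unitLaw D g₀ K).map (loopVec F G)` (`toMeasure_apexLaw_eq_map_unitLaw`), and as bundled probability measures
  `apexLaw D hM g₀ K = (unitLawP D g₀ hM K).map _` (`apexLaw_eq_map_unitLawP`).
* **WEAK CONVERGENCE PASSES DOWN**: if the field-level laws converge weakly along steps `κ n` to `μ`, the observable laws
  converge weakly along `κ n` to `μ.map loopVec` (`tendsto_apexLaw_of_tendsto_unitLawP`; continuity of push-forward under
  a continuous map); hence `Tendsto (unitLawP D g₀ hM) atTop (𝓝 μ) → HasContinuumLimit (D.scheme g₀)`
  (`hasContinuumLimit_of_tendsto_unitLawP`, through `T4LimitLaw.hasContinuumLimit_iff_exists_tendsto_law`), every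
  observable limit law along `κ n` is the push-forward of any field-level limit law along `κ n`
  (`limitLaw_eq_map_of_tendsto`), and at the apex: "under (B), the β-hypothesis and tuning the field-level laws converge
  weakly" ⇒ `D.ym4_torus_continuum_limit_exists` (`limit_exists_of_tendsto_unitLawP`, via
  `T4LimitLaw.limit_exists_iff_tendsto_law`).

WHAT IT IS NOT.  (a) NOT summit progress; nothing of the series is asserted; the open content of rung (B)+1 is untouched.
(b) The CONVERSE direction is NOT claimed: `loopVec` is constant on gauge orbits (loop variables are traces of
holonomies of closed walks), so it does not separate the points of `X`, and a `K`-dependent gauge rotation of the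
field-level laws is invisible to the observable laws — convergence / uniqueness of the observable laws (`T4LimitLaw`, the
content of `HasContinuumLimit`) is not asserted to give convergence / uniqueness of the field-level laws
(`T4LimitDensityT4`).  The observable law is the law of the gauge-invariant content only (DIVERGENCE D-pv01.9 stands).  (c) The continuity
hypotheses (`Re tr`, multiplication, inversion continuous; `G` second countable Borel) are those of
`T4LimitDensityT4` §2 and hold for closed subgroups of `U(N)` (its §4); they are hypotheses here, not facts.

Tags: every declaration `[folklore]`; no cite tag; no `def … : Prop` hypothesis shape.  Imports: `T4LimitLaw` (pv01),
`T4LimitDensityT4` (pv14) only; nothing in the tree is modified.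

v1 (2026-08-18, unit `b2b-balaban-pv01-g6`, SURGE NODE PROVER #01 gen 6; answers the pv14-g4 journal note
2026-08-18T22:33:49Z "either lineage may add it").
-/

open MeasureTheory Filter Topology

namespace Literature.MathematicalPhysics.QuantumFieldTheory.Balaban1983to89.T4LimitLawField

open Missing T4Continuum T4LimitLaw T4LimitDensityT4

variable (F : T4Family) (G : Type*) [GaugeGroup G] [MeasurableSpace G] [RegularGaugeGroup G] [HaarData G]

/-! ## §1 The loop vector on the unit-lattice configuration space -/

/-- THE LOOP VECTOR `X → [-1,1]^{ULoop F}`, `W ↦ (C ↦ unitObs C W)` (each entry clamped to `[-1,1]` by `Set.projIcc`; the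
clamp is the identity, `coe_loopVec_apply`). [folklore] -/
noncomputable def loopVec (W : UCfg F G) : Cube (ULoop F) :=
  fun C => Set.projIcc (-1 : ℝ) 1 (by norm_num) (unitObs F G C W)

omit [HaarData G] in
/-- The `C`-th entry of the loop vector is the loop variable `unitObs C`. [folklore] -/
@[simp] theorem coe_loopVec_apply (W : UCfg F G) (C : ULoop F) :
    ((loopVec F G W C : Set.Icc (-1 : ℝ) 1) : ℝ) = unitObs F G C W := by
  have hmem : unitObs F G C W ∈ Set.Icc (-1 : ℝ) 1 := Set.mem_Icc.mpr (abs_le.mp (abs_unitObs_le_one F G C W))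
  simp only [loopVec, Set.projIcc_of_mem _ hmem]

omit [HaarData G] in
/-- The loop vector is measurable for the product σ-algebras. [folklore] -/
theorem measurable_loopVec : Measurable (loopVec F G) :=
  measurable_pi_iff.mpr fun C => continuous_projIcc.measurable.comp (measurable_unitObs F G C)

omit [MeasurableSpace G] [HaarData G] [RegularGaugeGroup G] in
/-- The loop vector is continuous when `Re tr` and the group operations are. [folklore] -/
theorem continuous_loopVec [TopologicalSpace G] [ContinuousMul G] [ContinuousInv G]
    (hc : Continuous (reTr : G → ℝ)) : Continuous (loopVec F G) :=
  continuous_pi fun C => continuous_projIcc.comp (continuous_unitObs F G hc C)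

omit [HaarData G] in
/-- Monomials of the loop vector are the products of loop variables `unitObsProd`. [folklore] -/
theorem monomial_loopVec (Cs : List (ULoop F)) (W : UCfg F G) :
    monomial Cs (loopVec F G W) = unitObsProd F G Cs W := by
  simp only [monomial, coe_loopVec_apply, unitObsProd]

variable {F G}
variable (D : FiniteEpsData F G) (g₀ : ℕ → ℝ)

omit [RegularGaugeGroup G] in
/-- **The scheme's observable vector factors through the loop vector**: `obsVec (D.scheme g₀) K U =
loopVec (cfgEquiv K (avg^K U))` (`T4LimitDensityT4.avgObs_eq_unitObs`, entrywise). [folklore] -/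
theorem obsVec_scheme_eq (K : ℕ) (U : GaugeField (F.P K) 0 G) :
    obsVec (D.scheme g₀) K U = loopVec F G (cfgEquiv F G K (Averaging.iter (D.av K) K U)) := by
  funext C
  show Set.projIcc (-1 : ℝ) 1 _ (D.avgObs K C U) = Set.projIcc (-1 : ℝ) 1 _ (unitObs F G C _)
  rw [avgObs_eq_unitObs]

/-! ## §2 The observable law is the push-forward of the field-level law -/

/-- **`apexLaw = loopVec_* unitLaw`** at every step `K` (as measures on the cube). [folklore] -/
theorem toMeasure_apexLaw_eq_map_unitLaw (hM : D.AvgMeasurable) (K : ℕ) :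
    (apexLaw D hM g₀ K : Measure (Cube (ULoop F))) = (unitLaw D g₀ K).map (loopVec F G) := by
  rw [unitLaw, topLaw, Measure.map_map (measurable_loopVec F G) (cfgEquiv F G K).measurable,
    Measure.map_map ((measurable_loopVec F G).comp (cfgEquiv F G K).measurable)
      (measurable_iter (D.av K) (hM K) K)]
  show ((T4GenFunBounds.gibbsMeasure (F.P K) ((g₀ K)⁻¹ ^ 2)).map (obsVec (D.scheme g₀) K)) = _
  congr 1
  funext U
  exact obsVec_scheme_eq D g₀ K U

/-- … and as bundled probability measures: `apexLaw D hM g₀ K = (unitLawP D g₀ hM K).map loopVec`. [folklore] -/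
theorem apexLaw_eq_map_unitLawP (hM : D.AvgMeasurable) (K : ℕ) :
    apexLaw D hM g₀ K = (unitLawP D g₀ hM K).map (measurable_loopVec F G).aemeasurable := by
  apply ProbabilityMeasure.toMeasure_injective
  rw [ProbabilityMeasure.toMeasure_map, coe_unitLawP]
  exact toMeasure_apexLaw_eq_map_unitLaw D g₀ hM K

/-- Integrals against the observable law are integrals of the composite against the field-level law; in particular the
monomial integrals are `∫ unitObsProd Cs d(unitLaw K)` (= the joint expectations, `T4LimitDensityT4.expectAt_eq_integral_unitLaw`
/ `T4LimitLaw.integral_monomial_law`). [folklore] -/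
theorem integral_monomial_apexLaw_eq (hM : D.AvgMeasurable) (K : ℕ) (Cs : List (ULoop F)) :
    ∫ x, monomial Cs x ∂(apexLaw D hM g₀ K : Measure (Cube (ULoop F))) = ∫ W, unitObsProd F G Cs W ∂(unitLaw D g₀ K) := by
  rw [toMeasure_apexLaw_eq_map_unitLaw D g₀ hM K,
    integral_map (measurable_loopVec F G).aemeasurable (measurable_monomial Cs).aestronglyMeasurable]
  simp only [monomial_loopVec]

/-! ## §3 Weak convergence passes from the field-level laws to the observable laws -/

section Weak

variable [TopologicalSpace G] [SecondCountableTopology G] [BorelSpace G] [ContinuousMul G] [ContinuousInv G]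

/-- **FIELD-LEVEL WEAK CONVERGENCE ⇒ OBSERVABLE WEAK CONVERGENCE**: if `unitLawP (κ n) → μ` weakly on `X`, then
`apexLaw (κ n) → μ.map loopVec` weakly on the cube (push-forward under the continuous loop vector,
Mathlib `ProbabilityMeasure.tendsto_map_of_tendsto_of_continuous`). [folklore] -/
theorem tendsto_apexLaw_of_tendsto_unitLawP (hM : D.AvgMeasurable) (hc : Continuous (reTr : G → ℝ))
    {κ : ℕ → ℕ} {μ : ProbabilityMeasure (UCfg F G)} (h : Tendsto (fun n => unitLawP D g₀ hM (κ n)) atTop (𝓝 μ)) :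
    Tendsto (fun n => apexLaw D hM g₀ (κ n)) atTop
      (𝓝 (μ.map (continuous_loopVec F G hc).measurable.aemeasurable)) := by
  have hmap := ProbabilityMeasure.tendsto_map_of_tendsto_of_continuous _ _ h (continuous_loopVec F G hc)
  refine hmap.congr fun n => ?_
  rw [apexLaw_eq_map_unitLawP D g₀ hM (κ n)]

/-- **Every observable limit law along `κ n` is the push-forward of any field-level limit law along `κ n`.** [folklore] -/
theorem limitLaw_eq_map_of_tendsto (hM : D.AvgMeasurable) (hc : Continuous (reTr : G → ℝ))
    {κ : ℕ → ℕ} {μ : ProbabilityMeasure (UCfg F G)} {ν : ProbabilityMeasure (Cube (ULoop F))}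
    (hμ : Tendsto (fun n => unitLawP D g₀ hM (κ n)) atTop (𝓝 μ))
    (hν : Tendsto (fun n => apexLaw D hM g₀ (κ n)) atTop (𝓝 ν)) :
    ν = μ.map (continuous_loopVec F G hc).measurable.aemeasurable :=
  tendsto_nhds_unique hν (tendsto_apexLaw_of_tendsto_unitLawP D g₀ hM hc hμ)

/-- **Weak convergence of the field-level laws along the full sequence ⇒ `HasContinuumLimit (D.scheme g₀)`** (the
continuum limit of the joint expectations of all unit-scale loop variables exists, node U0, through
`T4LimitLaw.hasContinuumLimit_iff_exists_tendsto_law`). [folklore] -/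
theorem hasContinuumLimit_of_tendsto_unitLawP (hM : D.AvgMeasurable) (hc : Continuous (reTr : G → ℝ))
    {μ : ProbabilityMeasure (UCfg F G)} (h : Tendsto (unitLawP D g₀ hM) atTop (𝓝 μ)) :
    HasContinuumLimit (D.scheme g₀) :=
  (hasContinuumLimit_iff_exists_tendsto_law (D.scheme g₀) (fun K => (D.scheme_β_eq g₀ K).2)
    (fun K C => D.measurable_avgObs hM K C) (fun K C U => D.abs_avgObs_le_one K C U)).mpr
    ⟨_, tendsto_apexLaw_of_tendsto_unitLawP D g₀ hM hc (κ := id) h⟩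

/-- **AT THE APEX: "under (B), the β-hypothesis and tuning, the field-level laws of the averaged fields converge weakly on
`X`" ⇒ `D.ym4_torus_continuum_limit_exists`** (for any β-side hypothesis in the prefix, via
`T4LimitLaw.underHypotheses_exists_iff_tendsto_law`). [folklore] -/
theorem underHypotheses_exists_of_tendsto_unitLawP (hM : D.AvgMeasurable) (hc : Continuous (reTr : G → ℝ)) (Hβ : Prop)
    (h : D.UnderHypotheses Hβ (fun g₀ => ∃ μ : ProbabilityMeasure (UCfg F G), Tendsto (unitLawP D g₀ hM) atTop (𝓝 μ))) :
    D.UnderHypotheses Hβ (fun g₀ => ∃ E : List (ULoop F) → ℝ, IsLimitFunctional (D.scheme g₀).expectAt E) :=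
  (underHypotheses_exists_iff_tendsto_law D hM Hβ).mpr
    (FiniteEpsData.UnderHypotheses.mono
      (fun g₀ ⟨_, hμ⟩ => ⟨_, tendsto_apexLaw_of_tendsto_unitLawP D g₀ hM hc (κ := id) hμ⟩) h)

/-- … in particular for the tree's existence target (β-side hypothesis `BetaPertHyp D.βfun`). [folklore] -/
theorem limit_exists_of_tendsto_unitLawP (hM : D.AvgMeasurable) (hc : Continuous (reTr : G → ℝ))
    (h : D.UnderHypotheses (BetaPertHyp D.βfun)
      (fun g₀ => ∃ μ : ProbabilityMeasure (UCfg F G), Tendsto (unitLawP D g₀ hM) atTop (𝓝 μ))) :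
    D.ym4_torus_continuum_limit_exists :=
  (limit_exists_iff_tendsto_law D hM).mpr
    (FiniteEpsData.UnderHypotheses.mono
      (fun g₀ ⟨_, hμ⟩ => ⟨_, tendsto_apexLaw_of_tendsto_unitLawP D g₀ hM hc (κ := id) hμ⟩) h)

end Weak

end Literature.MathematicalPhysics.QuantumFieldTheory.Balaban1983to89.T4LimitLawField
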